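import Summits.CriticalPhenomena.Ising3DConformalLimit.Theorems.CoerciveSharpnessCoerciveReflectedGradientDefs
import Literature.Probability.LatticeModels.CriticalTwoPointLower
import HarnessLib

/-!
# Route `CoerciveSharpness`, crux `CoerciveReflectedGradient` (stmt-CriticalPhenomena-18197), line `base_box_rerun`:
# registered stub `stub_headSmall`

`theorem stub_headSmall : Sig.stub_headSmall` (vocabulary in
`Theorems/CoerciveSharpnessCoerciveReflectedGradientDefs.lean`): the "head" of the base-box rerun of
Duminil-Copin–Panis 2025 (arXiv:2404.05700) §2.2 — the union bound paying for the bad event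
`{Λ_m ⊄ 𝒮_n}` — is small:
`Σ_δ Σ_{z ∈ Λ_m} ⟨σ₀ σ_{𝓡_δ z − z}⟩_{β_c} ≤ C m³ / n` on `ℤ³` for `1 ≤ m`, `2m ≤ n`.

Proof: for `z ∈ Λ_m` the vector `v = 𝓡_δ z − z` has the single nonzero coordinate
`v_{δ.1} = 2(±n) − 2 z_{δ.1}`, so `‖v‖_∞ ≥ |2(±n) − 2 z_{δ.1}| ≥ 2(n − m) ≥ n > 0`; the infrared bound
`⟨σ₀σ_x⟩_{β} ≤ C₀/‖x‖^{d-2}` for `0 ≤ β ≤ β_c`, `d = 3` (`twoPointFree_le_of_le_criticalBeta`) bounds every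
term by `C₀/n`, and there are `2d · #Λ_m = 6 (2m+1)³ ≤ 162 m³` terms. Helper file
(`--supports stmt-CriticalPhenomena-18197`); no definition, no named fact as hypothesis.
-/

noncomputable section

open Finset

namespace Summit.CriticalPhenomena.Ising3DConformalLimit.Cruxes.CoerciveReflectedGradient.BaseBoxRerun

open scoped BigOperators Classical
open Literature.Probability.LatticeModels
open Literature.Probability.LatticeModels.DCPLower

/-- **The reflected displacement is long**: for `z ∈ Λ_m` and `2m ≤ n`, the displacement
`𝓡_δ z − z` (reflection in the hyperplane `x_{δ.1} = ±n`) has sup norm at least `n`: its `δ.1`-th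
coordinate is `2(±n) − 2 z_{δ.1}` and `|z_{δ.1}| ≤ m ≤ n/2`. [folklore] -/
theorem norm_dirRefl_sub_self_ge {m n : ℕ} (hmn : 2 * m ≤ n) (δ : Fin 3 × Bool) {z : Site 3}
    (hz : z ∈ box 3 m) : (n : ℝ) ≤ ‖dirRefl δ n z - z‖ := by
  obtain ⟨i, b⟩ := δ
  rw [mem_box] at hz
  obtain ⟨hz1, hz2⟩ := hz i
  have hvi : (dirRefl (i, b) n z - z) i = 2 * (sgn b * n) - z i - z i := by
    rw [Pi.sub_apply, dirRefl_apply, if_pos rfl]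
  have habs : (n : ℤ) ≤ |(dirRefl (i, b) n z - z) i| := by
    rw [hvi, le_abs]
    cases b
    · rw [sgn_false]
      right
      omega
    · rw [sgn_true]
      left
      omega
  have h1 : ‖(dirRefl (i, b) n z - z) i‖ ≤ ‖dirRefl (i, b) n z - z‖ := norm_le_pi_norm _ i
  rw [Int.norm_eq_abs, ← Int.cast_abs] at h1
  exact le_trans (by exact_mod_cast habs) h1

/-- **Stub D — the head is small** (registered stub `stub_headSmall` of line `base_box_rerun`):
`Σ_δ Σ_{z ∈ Λ_m} ⟨σ₀ σ_{𝓡_δ z − z}⟩_{β_c(3)} ≤ C m³ / n` for all `1 ≤ m`, `2m ≤ n`, by the union bound over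
the `6 (2m+1)³ ≤ 162 m³` terms and the infrared bound `⟨σ₀σ_x⟩_{β_c} ≤ C₀/‖x‖` on `ℤ³`
(`twoPointFree_le_of_le_criticalBeta`) at `‖𝓡_δ z − z‖ ≥ n` (`norm_dirRefl_sub_self_ge`); `C = 162 C₀`.
(Duminil-Copin–Panis 2025, §2.2, Lemma 2.4 + eq. (1.3), rerun with a base box.) -/
theorem stub_headSmall : Sig.stub_headSmall := by
  obtain ⟨C₀, hC₀, hIR⟩ := twoPointFree_le_of_le_criticalBeta (d := 3) le_rfl
  have hβ0 : (0 : ℝ) ≤ criticalBeta 3 := (criticalBeta_pos_holds (d := 3) (by norm_num)).le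
  refine ⟨162 * C₀, by positivity, fun m n hm hmn => ?_⟩
  have hnpos : (0 : ℝ) < n := by exact_mod_cast (show 0 < n by omega)
  -- every term is at most `C₀ / n`
  have hterm : ∀ δ : Fin 3 × Bool, ∀ z ∈ box 3 m,
      twoPointFree 3 (criticalBeta 3) (dirRefl δ n z - z) ≤ C₀ / n := by
    intro δ z hz
    have hnorm : (n : ℝ) ≤ ‖dirRefl δ n z - z‖ := norm_dirRefl_sub_self_ge hmn δ hz
    have hpos : (0 : ℝ) < ‖dirRefl δ n z - z‖ := lt_of_lt_of_le hnpos hnorm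
    have hne : dirRefl δ n z - z ≠ 0 := norm_pos_iff.mp hpos
    have h1 := hIR (criticalBeta 3) hβ0 le_rfl _ hne
    rw [show (3 : ℕ) - 2 = 1 from rfl, pow_one] at h1
    calc twoPointFree 3 (criticalBeta 3) (dirRefl δ n z - z)
        ≤ C₀ * (1 / ‖dirRefl δ n z - z‖) := h1
      _ ≤ C₀ * (1 / n) := mul_le_mul_of_nonneg_left (one_div_le_one_div_of_le hnpos hnorm) hC₀.le
      _ = C₀ / n := mul_one_div C₀ n
  -- count the terms: `2d · #Λ_m = 6 (2m+1)³ ≤ 162 m³`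
  have hm1 : (1 : ℝ) ≤ m := by exact_mod_cast hm
  have h27 : (2 * (m : ℝ) + 1) ^ 3 ≤ 27 * (m : ℝ) ^ 3 := by
    have h3m : 2 * (m : ℝ) + 1 ≤ 3 * m := by linarith
    calc (2 * (m : ℝ) + 1) ^ 3 ≤ (3 * m) ^ 3 := pow_le_pow_left₀ (by positivity) h3m 3
      _ = 27 * (m : ℝ) ^ 3 := by ring
  calc ∑ δ : Fin 3 × Bool, ∑ z ∈ box 3 m, twoPointFree 3 (criticalBeta 3) (dirRefl δ n z - z)
      ≤ ∑ δ : Fin 3 × Bool, ∑ z ∈ box 3 m, C₀ / n :=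
        Finset.sum_le_sum fun δ _ => Finset.sum_le_sum fun z hz => hterm δ z hz
    _ = 6 * (2 * (m : ℝ) + 1) ^ 3 * (C₀ / n) := by
        simp only [Finset.sum_const, Finset.card_univ, Fintype.card_prod, Fintype.card_fin,
          Fintype.card_bool, card_box, nsmul_eq_mul]
        push_cast
        ring
    _ = 6 * (2 * (m : ℝ) + 1) ^ 3 * C₀ / n := by ring
    _ ≤ 162 * C₀ * (m : ℝ) ^ 3 / n := by
        apply div_le_div_of_nonneg_right _ hnpos.le
        calc 6 * (2 * (m : ℝ) + 1) ^ 3 * C₀ = 6 * C₀ * (2 * (m : ℝ) + 1) ^ 3 := by ring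
          _ ≤ 6 * C₀ * (27 * (m : ℝ) ^ 3) := mul_le_mul_of_nonneg_left h27 (by positivity)
          _ = 162 * C₀ * (m : ℝ) ^ 3 := by ring

end Summit.CriticalPhenomena.Ising3DConformalLimit.Cruxes.CoerciveReflectedGradient.BaseBoxRerun

end
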